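import Mathlib.Analysis.SpecialFunctions.BinaryEntropy
import Mathlib.Analysis.SpecialFunctions.Sqrt
import Mathlib.Analysis.SpecialFunctions.Log.Deriv
import Mathlib.Analysis.Calculus.Deriv.Pow
import Mathlib.Analysis.Calculus.Deriv.Inv
import Mathlib.MeasureTheory.MeasurableSpace.Defs
import HarnessLib

/-!
# `stub_roomEntropyDrift`: the Itô drift of the room–entropy observable vanishes at κ = 8/3

Stub `stub_roomEntropyDrift` (sanity anchor F3b) of the registered skeleton of the line
`room-entropy-wright-fisher` for the crux `SubseqIdentification` (stmt-CriticalPhenomena-0783,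
route `SAWRenewalTightness`).

The room–entropy observable along the centred chordal Loewner flow `z_t = u + iv`
(`dz = (2/z) dt − dW`, `W = √κ B`) is `N_t = log ψ_t + 3 H(S_t)` with
`S = (1 + u/√(u² + v²))/2` and `d log ψ = 4v²/(u² + v²)² dt`; its generator part is
`(κ/2) ∂_uu + (2u/(u²+v²)) ∂_u − (2v/(u²+v²)) ∂_v`.  This file certifies in the kernel that at
`κ = 8/3` the drift of `N` vanishes identically: for `F(u, v) = 3 H((1 + u/√(u²+v²))/2)`
(`H = Real.binEntropy`, nats) and `v > 0`,
`(4/3) F_uu + (2u/(u²+v²)) F_u − (2v/(u²+v²)) F_v = −4v²/(u²+v²)²`.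

Computation (`r = √(u² + v²)`, `L = log(r − u) − log(r + u)`).  With `p = (1 + u/r)/2` one has
`p = (r + u)/(2r)`, `1 − p = (r − u)/(2r)`, so `H'(p) = log(1 − p) − log p = L`
(`Real.hasDerivAt_binEntropy`); `∂_u p = v²/(2r³)` and `∂_v p = −uv/(2r³)`, whence
`F_u = (3/2) L v²/r³`, `F_v = −(3/2) L uv/r³`.  Since `v > 0` is fixed, the closed form of
`F_u` holds at every `u`, so `F_uu` is the derivative of the closed form:
`∂_u L = (u/r − 1)/(r − u) − (u/r + 1)/(r + u) = −2/r` and `∂_u (v²/r³) = −3uv²/r⁵` give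
`F_uu = −3v²/r⁴ − (9/2) u v² L/r⁵`.  The `L`-terms cancel exactly in
`(4/3) F_uu + (2u/r²) F_u − (2v/r²) F_v` (that cancellation is "κ = 8/3"), leaving `−4v²/r⁴`.

No named fact is used; axioms `propext`, `Classical.choice`, `Quot.sound`.
-/

noncomputable section

open MeasureTheory Filter Topology Set
open scoped NNReal ENNReal Classical BigOperators

namespace Summit.CriticalPhenomena.SAWScalingLimit.Theorems.SubseqIdentification.RoomEntropy

/-- For `0 < v`: `|x| < √(x² + v²)`. -/
private theorem abs_lt_sqrt_sq_add_sq {v : ℝ} (hv : 0 < v) (x : ℝ) :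
    |x| < Real.sqrt (x ^ 2 + v ^ 2) := by
  rw [Real.lt_sqrt (abs_nonneg x), sq_abs]
  have : 0 < v ^ 2 := by positivity
  linarith

/-- Sign facts for `r = √(x² + v²)` when `0 < v`: `0 < r`, `0 < r − x`, `0 < r + x`. -/
private theorem sqrt_sq_add_sq_pos {v : ℝ} (hv : 0 < v) (x : ℝ) :
    0 < Real.sqrt (x ^ 2 + v ^ 2) ∧ 0 < Real.sqrt (x ^ 2 + v ^ 2) - x
      ∧ 0 < Real.sqrt (x ^ 2 + v ^ 2) + x := by
  have h := abs_lt_sqrt_sq_add_sq hv x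
  have h1 := le_abs_self x
  have h2 := neg_abs_le x
  refine ⟨?_, ?_, ?_⟩ <;> linarith [abs_nonneg x]

/-- `d/dx √(x² + v²) = x/√(x² + v²)` (`0 < v`). -/
private theorem hasDerivAt_sqrt_sq_add_sq {v : ℝ} (hv : 0 < v) (x : ℝ) :
    HasDerivAt (fun y => Real.sqrt (y ^ 2 + v ^ 2)) (x / Real.sqrt (x ^ 2 + v ^ 2)) x := by
  have h1 : HasDerivAt (fun y : ℝ => y ^ 2 + v ^ 2) (2 * x) x := by
    refine ((hasDerivAt_pow 2 x).add_const (v ^ 2)).congr_deriv ?_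
    norm_num
  have h2 := h1.sqrt (ne_of_gt (by positivity))
  refine h2.congr_deriv ?_
  rw [mul_div_mul_left _ _ (two_ne_zero)]

/-- `d/dy √(u² + y²) = y/√(u² + y²)` at `y = v > 0`. -/
private theorem hasDerivAt_sqrt_sq_add_sq' (u : ℝ) {v : ℝ} (hv : 0 < v) :
    HasDerivAt (fun y => Real.sqrt (u ^ 2 + y ^ 2)) (v / Real.sqrt (u ^ 2 + v ^ 2)) v := by
  have h1 : HasDerivAt (fun y : ℝ => u ^ 2 + y ^ 2) (2 * v) v := by
    refine ((hasDerivAt_pow 2 v).const_add (u ^ 2)).congr_deriv ?_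
    norm_num
  have h2 := h1.sqrt (ne_of_gt (by positivity))
  refine h2.congr_deriv ?_
  rw [mul_div_mul_left _ _ (two_ne_zero)]

/-- The room fraction `p(x) = (1 + x/√(x² + v²))/2` has `∂ₓ p = v²/(2r³)`, `r = √(x² + v²)`. -/
private theorem hasDerivAt_roomFrac_u {v : ℝ} (hv : 0 < v) (x : ℝ) :
    HasDerivAt (fun y => (1 + y / Real.sqrt (y ^ 2 + v ^ 2)) / 2)
      (v ^ 2 / (2 * Real.sqrt (x ^ 2 + v ^ 2) ^ 3)) x := by
  have hr := (sqrt_sq_add_sq_pos hv x).1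
  have hr2 : Real.sqrt (x ^ 2 + v ^ 2) ^ 2 = x ^ 2 + v ^ 2 := Real.sq_sqrt (by positivity)
  have h1 := (((hasDerivAt_id' x).fun_div (hasDerivAt_sqrt_sq_add_sq hv x) hr.ne').const_add
    (1 : ℝ)).div_const (2 : ℝ)
  refine h1.congr_deriv ?_
  generalize Real.sqrt (x ^ 2 + v ^ 2) = r at hr hr2 ⊢
  have hv2 : v ^ 2 = r ^ 2 - x ^ 2 := by linarith
  have hr0 : r ≠ 0 := hr.ne'
  rw [hv2]
  field_simp

/-- In the `v`-direction: `∂_y (1 + u/√(u² + y²))/2 = −uv/(2r³)` at `y = v > 0`. -/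
private theorem hasDerivAt_roomFrac_v (u : ℝ) {v : ℝ} (hv : 0 < v) :
    HasDerivAt (fun y => (1 + u / Real.sqrt (u ^ 2 + y ^ 2)) / 2)
      (-(u * v) / (2 * Real.sqrt (u ^ 2 + v ^ 2) ^ 3)) v := by
  have hr := (sqrt_sq_add_sq_pos hv u).1
  have hc : HasDerivAt (fun _ : ℝ => u) 0 v := hasDerivAt_const v u
  have h1 := ((hc.fun_div (hasDerivAt_sqrt_sq_add_sq' u hv) hr.ne').const_add (1 : ℝ)).div_const
    (2 : ℝ)
  refine h1.congr_deriv ?_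
  generalize Real.sqrt (u ^ 2 + v ^ 2) = r at hr ⊢
  have hr0 : r ≠ 0 := hr.ne'
  field_simp
  ring

/-- `H'` at the room fraction: with `r = √(x² + v²)`, `p = (1 + x/r)/2 ∉ {0, 1}` and
`log(1 − p) − log p = log(r − x) − log(r + x)`. -/
private theorem roomFrac_facts {v : ℝ} (hv : 0 < v) (x : ℝ) :
    (1 + x / Real.sqrt (x ^ 2 + v ^ 2)) / 2 ≠ 0 ∧ (1 + x / Real.sqrt (x ^ 2 + v ^ 2)) / 2 ≠ 1 ∧
      Real.log (1 - (1 + x / Real.sqrt (x ^ 2 + v ^ 2)) / 2)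
          - Real.log ((1 + x / Real.sqrt (x ^ 2 + v ^ 2)) / 2)
        = Real.log (Real.sqrt (x ^ 2 + v ^ 2) - x) - Real.log (Real.sqrt (x ^ 2 + v ^ 2) + x) := by
  obtain ⟨hr, hsub, hadd⟩ := sqrt_sq_add_sq_pos hv x
  generalize Real.sqrt (x ^ 2 + v ^ 2) = r at hr hsub hadd ⊢
  have hr0 : r ≠ 0 := hr.ne'
  have hp_eq : (1 + x / r) / 2 = (r + x) / (2 * r) := by
    field_simp
  have h1p_eq : 1 - (1 + x / r) / 2 = (r - x) / (2 * r) := by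
    field_simp
    ring
  refine ⟨?_, ?_, ?_⟩
  · rw [hp_eq]; positivity
  · intro h
    have h0 : 1 - (1 + x / r) / 2 = 0 := by rw [h]; ring
    rw [h1p_eq] at h0
    have : 0 < (r - x) / (2 * r) := by positivity
    exact this.ne' h0
  · rw [h1p_eq, hp_eq, Real.log_div hsub.ne' (by positivity), Real.log_div hadd.ne' (by positivity)]
    ring

/-- `∂_u F`: for fixed `v > 0` and every `x`,
`∂ₓ [3 H((1 + x/√(x²+v²))/2)] = (3/2) (log(r − x) − log(r + x)) · v²/r³`, `r = √(x² + v²)`. -/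
private theorem hasDerivAt_roomF_u {v : ℝ} (hv : 0 < v) (x : ℝ) :
    HasDerivAt (fun y => 3 * Real.binEntropy ((1 + y / Real.sqrt (y ^ 2 + v ^ 2)) / 2))
      (3 / 2 * (Real.log (Real.sqrt (x ^ 2 + v ^ 2) - x) - Real.log (Real.sqrt (x ^ 2 + v ^ 2) + x))
        * (v ^ 2 / Real.sqrt (x ^ 2 + v ^ 2) ^ 3)) x := by
  obtain ⟨hp0, hp1, hlog⟩ := roomFrac_facts hv x
  have hH := Real.hasDerivAt_binEntropy hp0 hp1
  have hcomp := hH.comp x (hasDerivAt_roomFrac_u hv x)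
  have h3 := hcomp.const_mul (3 : ℝ)
  refine h3.congr_deriv ?_
  rw [hlog]
  ring

/-- `∂_v F`: for `v > 0`,
`∂_y [3 H((1 + u/√(u²+y²))/2)] |_{y=v} = −(3/2) (log(r − u) − log(r + u)) · uv/r³`. -/
private theorem hasDerivAt_roomF_v (u : ℝ) {v : ℝ} (hv : 0 < v) :
    HasDerivAt (fun y => 3 * Real.binEntropy ((1 + u / Real.sqrt (u ^ 2 + y ^ 2)) / 2))
      (-(3 / 2) * (Real.log (Real.sqrt (u ^ 2 + v ^ 2) - u)
          - Real.log (Real.sqrt (u ^ 2 + v ^ 2) + u))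
        * (u * v / Real.sqrt (u ^ 2 + v ^ 2) ^ 3)) v := by
  obtain ⟨hp0, hp1, hlog⟩ := roomFrac_facts hv u
  have hH := Real.hasDerivAt_binEntropy hp0 hp1
  have hcomp := hH.comp v (hasDerivAt_roomFrac_v u hv)
  have h3 := hcomp.const_mul (3 : ℝ)
  refine h3.congr_deriv ?_
  rw [hlog]
  ring

/-- `∂_uu F`: the closed form of `∂_u F` has derivative
`−3v²/r⁴ − (9/2) u v² (log(r − u) − log(r + u))/r⁵` at `u` (`r = √(u² + v²)`), by the product
rule with `∂_u (log(r − u) − log(r + u)) = −2/r` and `∂_u (v²/r³) = −3uv²/r⁵`. -/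
private theorem hasDerivAt_roomF_u_closedForm {v : ℝ} (hv : 0 < v) (u : ℝ) :
    HasDerivAt (fun x => 3 / 2 * (Real.log (Real.sqrt (x ^ 2 + v ^ 2) - x)
        - Real.log (Real.sqrt (x ^ 2 + v ^ 2) + x)) * (v ^ 2 / Real.sqrt (x ^ 2 + v ^ 2) ^ 3))
      (-(3 * v ^ 2 / Real.sqrt (u ^ 2 + v ^ 2) ^ 4)
        - 9 / 2 * u * v ^ 2 * (Real.log (Real.sqrt (u ^ 2 + v ^ 2) - u)
            - Real.log (Real.sqrt (u ^ 2 + v ^ 2) + u)) / Real.sqrt (u ^ 2 + v ^ 2) ^ 5) u := by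
  obtain ⟨hr, hsub, hadd⟩ := sqrt_sq_add_sq_pos hv u
  have hr' := hasDerivAt_sqrt_sq_add_sq hv u
  have hL1 := (hr'.fun_sub (hasDerivAt_id' u)).log hsub.ne'
  have hL2 := (hr'.fun_add (hasDerivAt_id' u)).log hadd.ne'
  have hL := (hL1.fun_sub hL2).const_mul (3 / 2 : ℝ)
  have hcube : HasDerivAt (fun y => Real.sqrt (y ^ 2 + v ^ 2) ^ 3)
      (3 * Real.sqrt (u ^ 2 + v ^ 2) ^ 2 * (u / Real.sqrt (u ^ 2 + v ^ 2))) u := by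
    refine (hr'.fun_pow 3).congr_deriv ?_
    norm_num
  have hc : HasDerivAt (fun _ : ℝ => v ^ 2) 0 u := hasDerivAt_const u (v ^ 2)
  have hB := hc.fun_div hcube (pow_ne_zero 3 hr.ne')
  have h := hL.fun_mul hB
  refine h.congr_deriv ?_
  generalize Real.sqrt (u ^ 2 + v ^ 2) = r at hr hsub hadd ⊢
  have hr0 : r ≠ 0 := hr.ne'
  have hsub0 : r - u ≠ 0 := hsub.ne'
  have hadd0 : r + u ≠ 0 := hadd.ne'
  field_simp
  ring

/-- **The Itô drift of the room–entropy observable vanishes at κ = 8/3** (registered stub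
`stub_roomEntropyDrift`, sanity anchor F3b of the line `room-entropy-wright-fisher`, crux
`SubseqIdentification`, stmt-CriticalPhenomena-0783): for
`F(u, v) = 3 H((1 + u/√(u² + v²))/2)` and `v > 0`,
`(4/3) F_uu + (2u/(u²+v²)) F_u − (2v/(u²+v²)) F_v = −4v²/(u²+v²)²`, i.e. the generator
`(κ/2)∂_uu + Re(2/z)∂_u + Im(2/z)∂_v` of the centred chordal Loewner flow applied to `3H(S)`
exactly cancels `d log ψ/dt = 4v²/|z|⁴` at `κ = 8/3`.  Proof: closed forms of `F_u`, `F_v`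
through `Real.hasDerivAt_binEntropy` and the chain rule; `F_uu` as the derivative of the closed
form of `F_u` (valid at every `u` since `v > 0` is fixed); then field algebra in
`r = √(u² + v²)`, in which the logarithmic terms cancel. -/
theorem stub_roomEntropyDrift :
    let F : ℝ → ℝ → ℝ := fun u v => 3 * Real.binEntropy ((1 + u / Real.sqrt (u ^ 2 + v ^ 2)) / 2)
    ∀ u v : ℝ, 0 < v →
      (4 / 3 : ℝ) * deriv (fun x => deriv (fun y => F y v) x) u
          + (2 * u / (u ^ 2 + v ^ 2)) * deriv (fun y => F y v) u
          - (2 * v / (u ^ 2 + v ^ 2)) * deriv (fun y => F u y) v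
        = -(4 * v ^ 2 / (u ^ 2 + v ^ 2) ^ 2) := by
  intro F u v hv
  dsimp only [F]
  have h2 : deriv (fun x => deriv
        (fun y => 3 * Real.binEntropy ((1 + y / Real.sqrt (y ^ 2 + v ^ 2)) / 2)) x) u
      = -(3 * v ^ 2 / Real.sqrt (u ^ 2 + v ^ 2) ^ 4)
        - 9 / 2 * u * v ^ 2 * (Real.log (Real.sqrt (u ^ 2 + v ^ 2) - u)
            - Real.log (Real.sqrt (u ^ 2 + v ^ 2) + u)) / Real.sqrt (u ^ 2 + v ^ 2) ^ 5 := by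
    have hfun : (fun x => deriv
          (fun y => 3 * Real.binEntropy ((1 + y / Real.sqrt (y ^ 2 + v ^ 2)) / 2)) x)
        = fun x => 3 / 2 * (Real.log (Real.sqrt (x ^ 2 + v ^ 2) - x)
            - Real.log (Real.sqrt (x ^ 2 + v ^ 2) + x)) * (v ^ 2 / Real.sqrt (x ^ 2 + v ^ 2) ^ 3) :=
      funext fun x => (hasDerivAt_roomF_u hv x).deriv
    rw [hfun]
    exact (hasDerivAt_roomF_u_closedForm hv u).deriv
  have h1 : deriv (fun y => 3 * Real.binEntropy ((1 + y / Real.sqrt (y ^ 2 + v ^ 2)) / 2)) u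
      = 3 / 2 * (Real.log (Real.sqrt (u ^ 2 + v ^ 2) - u) - Real.log (Real.sqrt (u ^ 2 + v ^ 2) + u))
        * (v ^ 2 / Real.sqrt (u ^ 2 + v ^ 2) ^ 3) :=
    (hasDerivAt_roomF_u hv u).deriv
  have h3 : deriv (fun y => 3 * Real.binEntropy ((1 + u / Real.sqrt (u ^ 2 + y ^ 2)) / 2)) v
      = -(3 / 2) * (Real.log (Real.sqrt (u ^ 2 + v ^ 2) - u)
          - Real.log (Real.sqrt (u ^ 2 + v ^ 2) + u))
        * (u * v / Real.sqrt (u ^ 2 + v ^ 2) ^ 3) :=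
    (hasDerivAt_roomF_v u hv).deriv
  rw [h2, h1, h3]
  have hr : 0 < Real.sqrt (u ^ 2 + v ^ 2) := (sqrt_sq_add_sq_pos hv u).1
  have hr2 : Real.sqrt (u ^ 2 + v ^ 2) ^ 2 = u ^ 2 + v ^ 2 := Real.sq_sqrt (by positivity)
  generalize Real.sqrt (u ^ 2 + v ^ 2) = r at hr hr2 ⊢
  rw [← hr2]
  have hr0 : r ≠ 0 := hr.ne'
  field_simp
  ring

end Summit.CriticalPhenomena.SAWScalingLimit.Theorems.SubseqIdentification.RoomEntropy

end
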